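import Summits.BirchSwinnertonDyer.Rank1Residual.Additive.WildThreeDivisibilitySuffices
import HarnessLib

/-!
# Route `RamifiedHeegnerPair`, deciding crux L₁ `Gss2LowerAtThreeRankOne` (stmt-BirchSwinnertonDyer-26021) — Kolyvagin's structure
# theorem at `3`: the typed two-sided SHAPE implies the one-sided lower form the line consumes (pure logic)

HONEST FRAMING. Theorems only; helper file (`--supports stmt-BirchSwinnertonDyer-26021`); no definition, no named fact, no
`sorry`; nothing is booked, no item is closed, BSD is not proved for any curve. Lead prover bsd-line-rhp-p1 g4, 2026-08-28.
ROUTE-CONE-FREE: imports only the b2b/o5o6 typing files `Rank1Residual/Additive/WildThree{RefinedKolyvagin,DivisibilitySuffices}.lean`.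

WHY. The split-field Kolyvagin road for L₁ (`…Gss2LowerAtThreeRankOneKolyvaginRoad*.lean`, p610432/p611832/p612743, and the
joint capstone p614585) carries Kolyvagin's structure theorem at `3` as the hypothesis
`AdditiveThree.OneClassLowerBoundShape` — a ONE-SIDED form («some Kolyvagin class not `3^{m+1}`-divisible ⇒
`2·ord₃[E(K):ℤP] ≤ ord₃ #Ш(E/K) + 2m`») written by the b2b typers next to, but not derived from, the SHAPE in which the published
theorem is to be cited, `AdditiveThree.KolyvaginStructureThreeShape` («`M_∞ = m` ⇒ `Ш(E/K)` finite and
`ord₃ #Ш(E/K) + 2m = 2·ord₃[E(K):ℤP]`»; Kolyvagin 1991 / McCallum 1991 Thm. 5.4 + Cor. 5.6 / W. Zhang 2014 Thm. 10.2). This file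
proves the implication `KolyvaginStructureThreeShape → OneClassLowerBoundShape` by pure logic over the o6 bookkeeping file
`WildThreeDivisibilitySuffices` (`minftyGe_mono`, `minftyGe_zero`, `exists_minftyEq_of_not_minftyGe`): a failure of
`3^{m+1}`-divisibility yields an exact index `M_∞ = m'`, necessarily `≤ m` by monotonicity, where the two-sided shape applies.
Hence every theorem of the road stated under `OneClassLowerBoundShape` holds under the citable SHAPE, and the road's Heegner-side
inputs on the tower rows read: [the published structure theorem, as typed] ∧ [`AdditiveThree.RKC3Indivisibility`, the
indivisibility half of the refined Kolyvagin conjecture at an additive `3`]. Nothing here asserts either shape.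

* `exists_minftyEq_le_of_not_minftyGe` — a failure of `3^{m+1}`-divisibility gives an exact index `M_∞ = m' ≤ m`;
* `oneClassLowerBoundShape_of_kolyvaginStructureThreeShape` — the implication.

References: [cite: McCallumLMS1991, Thm. 5.4 (p. 288), Cor. 5.6 (p. 310), Lemma 5.1 (p. 303)] [cite: WZhang2014, §3.8 (p. 213),
Thm. 10.2, Remark 18] [cite: Kolyvagin1991MathAnn, Thm. 1] [cite: JetchevLauterStein2009, Prop. 4.1–4.2].
-/

-- D-0017: single-problem summit, so `Summit.BirchSwinnertonDyer.BirchSwinnertonDyer.…` repeats a namespace BY DESIGN.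
set_option linter.dupNamespace false
set_option autoImplicit false

noncomputable section

open scoped Classical

open WeierstrassCurve Literature.NumberTheory.EllipticCurves Literature.NumberTheory.EllipticCurves.ModularForms
  Summit.BirchSwinnertonDyer.Rank1Residual Summit.BirchSwinnertonDyer.Rank1Residual.AdditiveThree

namespace Summit.BirchSwinnertonDyer.BirchSwinnertonDyer.Theorems.RamifiedPairLowerBound

/-! ## §14 A failure of `3^{m+1}`-divisibility pins down an exact index `M_∞ = m' ≤ m` -/

/-- **`¬ (M_∞ ≥ m+1) ⇒ M_∞ = m'` for some `m' ≤ m`**: the o6 lemma `AdditiveThree.exists_minftyEq_of_not_minftyGe` gives an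
exact index `m'`; if `m' ≥ m + 1` then `MinftyGe … m'` would give `MinftyGe … (m+1)` by `AdditiveThree.minftyGe_mono`.
[folklore] -/
theorem exists_minftyEq_le_of_not_minftyGe
    (W : WeierstrassCurve ℚ) [W.IsGloballyMinimal] (K : Type) [Field K] [NumberField K] [NeZero (W.conductorNorm ℤ)]
    (Dt : ModularParametrizationData W (W.conductorNorm ℤ)) (β : ℤ) (ι : K →+* ℂ)
    {m : ℕ} (h : ¬ MinftyGe W K Dt β ι (m + 1)) :
    ∃ m' ≤ m, MinftyEq W K Dt β ι m' := by
  obtain ⟨m', hEq⟩ := AdditiveThree.exists_minftyEq_of_not_minftyGe W K Dt β ι h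
  refine ⟨m', ?_, hEq⟩
  by_contra hlt
  exact h (AdditiveThree.minftyGe_mono W K Dt β ι (by omega) hEq.1)

/-! ## §15 The two-sided SHAPE of the structure theorem implies the one-sided lower form -/

/-- **`KolyvaginStructureThreeShape → OneClassLowerBoundShape`.** Under the typed SHAPE of Kolyvagin's structure theorem at `3`
(`M_∞ = m'` at a datum with `ρ_{E,3^∞}` onto, `K` imaginary quadratic Heegner with `d_K ∉ {−3,−4}`, `P = y_K` non-torsion ⇒
`Ш(E/K)` finite and `ord₃ #Ш(E/K) + 2m' = 2·ord₃[E(K):ℤP]`), ONE Kolyvagin class of the datum that is not `3^{m+1}`-divisible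
gives `2·ord₃[E(K):ℤP] ≤ ord₃ #Ш(E/K) + 2m`: the failure fixes `M_∞ = m'` for some `m' ≤ m` (§14) and the identity at `m'`
gives the inequality at `m`. So the line `kolyvagin_split`'s structure hypothesis is implied by the citable shape (McCallum 1991
Thm. 5.4 / Cor. 5.6 as typed by cell b2b/o5o6); neither is asserted here. [cite: McCallumLMS1991, Thm. 5.4 (p. 288) and Cor. 5.6 (p. 310)]
[cite: WZhang2014, Thm. 10.2 and Remark 18] -/
theorem oneClassLowerBoundShape_of_kolyvaginStructureThreeShape (hS : KolyvaginStructureThreeShape) :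
    OneClassLowerBoundShape := by
  intro W _ _ hρ K _ _ hK h3 h4 _ hHN Dt H ι P hP hnt m hnot
  obtain ⟨m', hm', hEq⟩ := exists_minftyEq_le_of_not_minftyGe W K Dt H.β ι hnot
  obtain ⟨-, h⟩ := hS W hρ K hK h3 h4 hHN Dt H ι P hP hnt m' hEq
  omega

end Summit.BirchSwinnertonDyer.BirchSwinnertonDyer.Theorems.RamifiedPairLowerBound

end
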